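import Summits.NavierStokesRegularity.NavierStokesRegularity.Theorems.SymmetryModuliCountLinearLiouvilleSevenOfTarget
import Summits.NavierStokesRegularity.NavierStokesRegularity.Theorems.SqueezeCycleExtremalBiaxialitySubcriticalSmallConstant
import HarnessLib

/-!
# `LinearLiouvilleSeven`, background by background (item stmt-NavierStokesRegularity-4054)

Route `SymmetryModuliCount`, sub-problem `NavierStokesRegularity`. The support item
`LinearLiouvilleSeven` (LL7) quantifies over all backgrounds `u ∈ A_C` (smooth, divergence free,
KNSS-mild in the Oseen gauge, `‖u(t,x)‖ ≤ C/√(−t)` on `t < 0`) and asserts that any seven tempered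
classical solutions of the Navier–Stokes system linearised about `u` are linearly dependent modulo
slice-wise constants. Globally the item is the route target in costume,
`LL7 ↔ X = TypeIAncientLiouville` (`linearLiouvilleSeven_iff_typeIAncientLiouville`, file
`SymmetryModuliCountLinearLiouvilleSevenOfTarget`). This file sharpens that to a statement about
EACH background and records the one regime where the item is already a theorem:

* `dependentModSlice_of_background_eq_zero` — about a background vanishing on `t < 0` the
  conclusion of LL7 holds for every tempered seven-family (the `u = 0` anchor `atZero_holds`:
  tempered ancient Stokes families are dependent modulo constants);
* `background_eq_zero_of_linearLiouvilleSevenAt` — conversely, if the conclusion of LL7 holds for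
  every tempered seven-family about ONE `u ∈ A_C`, then `u ≡ 0` on `t < 0` (the seven modulated
  Galilean Jacobi fields `φₖ′e − φₖ∂ₑu`, `φₖ = (1 − t)^{−(k+1)}`, are admissible about every element
  of `A_C` by `galileanAdmissible_of_inClassA`; a slice-constant combination freezes `∂ₑu` off the
  finitely many zeros of the total modulation, frozen bounded slices are constant, and the Oseen
  equation plus the Type-I decay kill constants — the argument of the cdisprove seat's
  `linearLiouvilleSeven_false_of_galileanNontrivial`, run at a single background);
* `linearLiouvilleSevenAt_iff_background_eq_zero` — hence, for `u ∈ A_C`: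
  (LL7 about `u`) `↔ u ≡ 0` on `t < 0`. The failure set of the item inside `A_C` is exactly
  `A_C ∖ {0}`, background by background (not only globally);
* `linearLiouvilleSeven_smallConstant` — the item HOLDS unconditionally in the small-constant
  regime: there is a universal `ε > 0` with LL7 true about every `u ∈ A_C`, `C ≤ ε` (small Type-I
  constants carry no ancient dynamics, `exists_typeIAncientMild_eq_zero_of_small`: Leray's lower
  blow-up-rate bound in ancient form, KNSS 2009 §4). All content of the item sits at `C > ε`,
  `u ≠ 0`, i.e. exactly at a counterexample to `X`;
* `stub_linearLiouvilleSevenPointwise`, `stub_linearLiouvilleSevenSmallConstant` — the same two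
  facts in the registered raw vocabulary of the route file.

## References

* G. Koch, N. Nadirashvili, G. Seregin, V. Šverák, *Liouville theorems for the Navier–Stokes
  equations and applications*, Acta Math. 203 (2009) = arXiv:0709.3599, §1 ((1.4), the parasitic
  solutions), §4 p. 8 (the bilinear bound), Prop. 4.1. [KNSS2009]
* J. Leray, Acta Math. 63 (1934), (3.9) (lower bound on the blow-up rate). [Leray1934]
* Cruxes/LinearLiouvilleSeven/Disproof.lean §1, §4; Lines/galilean-collapse.md.
-/

noncomputable section

set_option linter.dupNamespace false -- tree namespace `Summit.<S>.<S>.Theorems` (summit = sub-problem), as in every Theorems file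

open Set Function MeasureTheory
open scoped Laplacian ContDiff Topology RealInnerProductSpace BigOperators

namespace Summit.NavierStokesRegularity.NavierStokesRegularity.Theorems

open Literature.Analysis Literature.Analysis.FluidPDE
open Summit.NavierStokesRegularity.NavierStokesRegularity.Theses.SymmetryModuliCount
open Summit.NavierStokesRegularity.NavierStokesRegularity.Theorems.LinearLiouvilleSeven.Negative

/-! ### A vanishing background: the anchor -/

/-- **About a background vanishing on `t < 0` the item's conclusion holds**: the linearised
operator about `u` is then the Stokes operator on `t < 0` (`sevenTempered_zero_of_slice_zero`) and
tempered ancient Stokes seven-families are dependent modulo slice-wise constants (`atZero_holds`).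
[cite: KochNadirashviliSereginSverak2009, §1 (1.4)] -/
theorem dependentModSlice_of_background_eq_zero {u : ℝ → E3 → E3}
    (hz : ∀ t < 0, ∀ x, u t x = 0) (v : Fin 7 → ℝ → E3 → E3) (q : Fin 7 → ℝ → E3 → ℝ)
    (h : SevenTempered u v q) : DependentModSlice v :=
  atZero_holds v q ((sevenTempered_iff 0 v q).1 (sevenTempered_zero_of_slice_zero hz h))

/-! ### The item about one element of `A_C` forces that element to vanish -/

/-- **The item about ONE background `u ∈ A_C` forces `u ≡ 0` on `t < 0`.** If every tempered
seven-family of linearised solutions about `u` is dependent modulo slice-wise constants, apply this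
(per coordinate direction `e_j`) to the seven modulated Galilean Jacobi fields
`φₖ′ e_j − φₖ ∂_j u`, `φₖ = (1 − t)^{−(k+1)}` (admissible about every element of `A_C`,
`galileanAdmissible_of_inClassA`): the resulting slice-constant combination freezes `∂_j u(t, ·)`
off the finite zero set of the total modulation `Σ cₖφₖ` (`finite_zeroSet`), frozen partials of a
bounded slice vanish (`slice_const_of_frozen`), the Oseen integral equation propagates
"constant slices off a null set of times" to `u(t, x) = u(s, 0)` for good `s < t`
(`mild_eq_const`), and `‖u(s, 0)‖ ≤ C/√(−s) → 0` as `s → −∞`. This is the argument of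
`linearLiouvilleSeven_false_of_galileanNontrivial` (cdisprove seat, p74875) run at a single
background. [cite: KochNadirashviliSereginSverak2009, §1 (1.4), Prop. 4.1] -/
theorem background_eq_zero_of_linearLiouvilleSevenAt {C : ℝ} {u : ℝ → E3 → E3}
    (hA : InClassA C u)
    (hLL : ∀ (v : Fin 7 → ℝ → E3 → E3) (q : Fin 7 → ℝ → E3 → ℝ),
      SevenTempered u v q → DependentModSlice v) :
    ∀ t < 0, ∀ x, u t x = 0 := by
  have hGal : GalileanAdmissible u := galileanAdmissible_of_inClassA hA
  intro t₀ ht₀ x₀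
  by_contra hne
  -- S1: the hypothesis applied, for each direction, to the seven modulated Galilean modes
  have step1 : ∀ j : Fin 3, ∃ c : Fin 7 → ℝ, c ≠ 0 ∧ ∀ t < 0, ∃ b : E3, ∀ x,
      ∑ i, c i • galMode u (EuclideanSpace.single j 1) (phiMod i) t x = b := by
    intro j
    choose q hq using
      fun i : Fin 7 => hGal (EuclideanSpace.single j 1) (phiMod i) (phiMod_isModulation i)
    exact hLL (fun i => galMode u (EuclideanSpace.single j 1) (phiMod i)) q
      ((sevenTempered_iff u _ q).2 hq)
  choose c hc hdep using step1
  -- the finite set of bad times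
  set Z : Set ℝ := ⋃ j : Fin 3, {t : ℝ | ∑ i, c j i * phiMod i t = 0} with hZdef
  have hZ : Z.Finite := Set.finite_iUnion fun j => finite_zeroSet (hc j)
  obtain ⟨hsm, -, hmild, hTI⟩ := hA
  have hdiff : ∀ t < 0, Differentiable ℝ (u t) := fun t ht =>
    ((show IsSmoothSpaceTimeOn (Set.Iio 0) u from hsm).contDiff_slice ht).differentiable (by simp)
  -- S2–S5: off `Z` every slice of `u` is constant
  have hconst : ∀ τ, τ < 0 → τ ∉ Z → ∀ y, u τ y = u τ 0 := by
    intro τ hτ hτZ y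
    have hΦ : ∀ j : Fin 3, ∑ i, c j i * phiMod i τ ≠ 0 := fun j hj =>
      hτZ (Set.mem_iUnion.2 ⟨j, hj⟩)
    have hfro : ∀ j : Fin 3, ∀ x, fderiv ℝ (u τ) x (EuclideanSpace.single j 1) =
        fderiv ℝ (u τ) 0 (EuclideanSpace.single j 1) := fun j x =>
      fderiv_apply_const_of_sliceConstant (hdep j τ hτ) (hΦ j) x
    exact slice_const_of_frozen (hdiff τ hτ) hfro (fun x => hTI τ hτ x) y
  -- S6: `u t₀ x₀ = u s 0` for every good time `s < t₀`
  have hval : ∀ s, s < t₀ → s ∉ Z → u t₀ x₀ = u s 0 := fun s hs hsZ =>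
    mild_eq_const hmild hZ hs ht₀ hsZ hconst x₀
  -- S7: Type-I decay along `s → −∞`
  have hpos : 0 < ‖u t₀ x₀‖ := norm_pos_iff.2 hne
  obtain ⟨L, hL⟩ := hZ.bddBelow
  set R : ℝ := (C / ‖u t₀ x₀‖) ^ 2 with hR
  set s : ℝ := min (min t₀ L) (-R) - 1 with hsdef
  have hm1 : min (min t₀ L) (-R) ≤ t₀ := (min_le_left _ _).trans (min_le_left _ _)
  have hm2 : min (min t₀ L) (-R) ≤ L := (min_le_left _ _).trans (min_le_right _ _)
  have hm3 : min (min t₀ L) (-R) ≤ -R := min_le_right _ _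
  have hs_t : s < t₀ := by linarith
  have hsZ : s ∉ Z := fun h => by have := hL h; linarith
  have hs0 : s < 0 := hs_t.trans ht₀
  have key := hval s hs_t hsZ
  have hTIs := hTI s hs0 0
  rw [← key] at hTIs
  have hRs : R + 1 ≤ -s := by linarith
  have hR0 : 0 ≤ R := sq_nonneg _
  have hrs : 0 < Real.sqrt (-s) := Real.sqrt_pos.2 (by linarith)
  have hsqrt : |C / ‖u t₀ x₀‖| < Real.sqrt (-s) := by
    rw [← Real.sqrt_sq_eq_abs]
    exact Real.sqrt_lt_sqrt (sq_nonneg _) (by linarith)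
  have hlt : C / Real.sqrt (-s) < ‖u t₀ x₀‖ := by
    rw [div_lt_iff₀ hrs]
    have h1 : C / ‖u t₀ x₀‖ < Real.sqrt (-s) := lt_of_le_of_lt (le_abs_self _) hsqrt
    rw [div_lt_iff₀ hpos] at h1
    linarith [mul_comm (Real.sqrt (-s)) ‖u t₀ x₀‖]
  linarith

/-- **Background-by-background dichotomy.** For `u ∈ A_C` the item's conclusion about `u`
(every tempered seven-family of linearised solutions about `u` is dependent modulo slice-wise
constants) holds if and only if `u ≡ 0` on `t < 0`. So inside each `A_C` the item fails exactly
on `A_C ∖ {0}`: settling it about any single background is settling whether that background is a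
counterexample to the route target `X`. [cite: KochNadirashviliSereginSverak2009, §1 (1.4), Prop. 4.1] -/
theorem linearLiouvilleSevenAt_iff_background_eq_zero {C : ℝ} {u : ℝ → E3 → E3}
    (hA : InClassA C u) :
    (∀ (v : Fin 7 → ℝ → E3 → E3) (q : Fin 7 → ℝ → E3 → ℝ),
        SevenTempered u v q → DependentModSlice v) ↔ ∀ t < 0, ∀ x, u t x = 0 :=
  ⟨background_eq_zero_of_linearLiouvilleSevenAt hA,
    fun hz v q h => dependentModSlice_of_background_eq_zero hz v q h⟩

/-! ### The small-constant regime: the item holds -/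

/-- **The item holds in the small-constant regime, unconditionally**: there is a universal
`ε > 0` such that about every `u ∈ A_C` with `C ≤ ε` any seven tempered linearised solutions are
dependent modulo slice-wise constants — because such a `u` vanishes on `t < 0`
(`exists_typeIAncientMild_eq_zero_of_small`: the Type-I bound `M/√(−t)` halves itself while
`32 C_B M ≤ 1`, `C_B` the constant of the `L^∞` bound of the Oseen bilinear term) and the anchor
applies. [cite: Leray1934, (3.9); KochNadirashviliSereginSverak2009, §4 p. 8] -/
theorem linearLiouvilleSeven_smallConstant :
    ∃ ε : ℝ, 0 < ε ∧ ∀ (C : ℝ) (u : ℝ → E3 → E3), InClassA C u → C ≤ ε →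
      ∀ (v : Fin 7 → ℝ → E3 → E3) (q : Fin 7 → ℝ → E3 → ℝ),
        SevenTempered u v q → DependentModSlice v := by
  obtain ⟨ε, hε, hsmall⟩ := exists_typeIAncientMild_eq_zero_of_small
  exact ⟨ε, hε, fun C u hA hC v q h =>
    dependentModSlice_of_background_eq_zero (hsmall C u (isTypeIAncientMild_iff.2 hA) hC) v q h⟩

/-- **The large-constant residual is the whole item**: `LinearLiouvilleSeven` is equivalent to its
restriction to Type-I constants above the universal threshold `ε` of
`linearLiouvilleSeven_smallConstant`. [cite: KochNadirashviliSereginSverak2009, §4 p. 8] -/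
theorem linearLiouvilleSeven_iff_largeConstant :
    ∃ ε : ℝ, 0 < ε ∧ (LinearLiouvilleSeven ↔ ∀ (C : ℝ) (u : ℝ → E3 → E3), ε < C → InClassA C u →
      ∀ (v : Fin 7 → ℝ → E3 → E3) (q : Fin 7 → ℝ → E3 → ℝ),
        SevenTempered u v q → DependentModSlice v) := by
  obtain ⟨ε, hε, hsmall⟩ := linearLiouvilleSeven_smallConstant
  refine ⟨ε, hε, fun h C u _ hA v q hvq => (linearLiouvilleSeven_iff.1 h) C u hA v q hvq, fun h => ?_⟩
  rw [linearLiouvilleSeven_iff]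
  intro C u hA v q hvq
  rcases le_or_gt C ε with hC | hC
  · exact hsmall C u hA hC v q hvq
  · exact h C u hC hA v q hvq

/-! ### Registered forms (raw route vocabulary) -/

/-- **Registered stub `stub_linearLiouvilleSevenPointwise` of item stmt-NavierStokesRegularity-4054**
(raw vocabulary of the route file): for every background in `A_C`, the conclusion of
`LinearLiouvilleSeven` about it holds iff the background vanishes on `t < 0`.
[cite: KochNadirashviliSereginSverak2009, §1 (1.4), Prop. 4.1] -/
theorem stub_linearLiouvilleSevenPointwise :
    ∀ (C : ℝ) (u : ℝ → EuclideanSpace ℝ (Fin 3) → EuclideanSpace ℝ (Fin 3)), ContDiffOn ℝ (⊤ : ℕ∞)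
      (Function.uncurry u) (Set.Iio 0 ×ˢ Set.univ) ∧ (∀ t < 0,
      Literature.Analysis.FluidPDE.VectorCalculus.IsDivFree (u t)) ∧ (∀ s t : ℝ, s < t → t < 0 → ∀
      x, u t x = Literature.Analysis.FluidPDE.heatFlow (u s) (t - s) x - ∫ τ in Set.Ioo s t, ∫ y,
      Literature.Analysis.FluidPDE.oseenKernel (t - τ) (x - y) (u τ y) (u τ y)) ∧
      Literature.Analysis.FluidPDE.HasTypeITimeDecay C u → ((∀ (v : Fin 7 → ℝ → EuclideanSpace ℝ
      (Fin 3) → EuclideanSpace ℝ (Fin 3)) (q : Fin 7 → ℝ → EuclideanSpace ℝ (Fin 3) → ℝ), (∀ i,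
      (ContDiffOn ℝ (⊤ : ℕ∞) (Function.uncurry (v i)) (Set.Iio 0 ×ˢ Set.univ) ∧ ContDiffOn ℝ (⊤ :
      ℕ∞) (Function.uncurry (q i)) (Set.Iio 0 ×ˢ Set.univ) ∧ (∃ K : ℝ, ∀ t < 0, ∀ x, ‖(v i) t x‖ ≤ K
      / Real.sqrt (-t) + K * (1 + ‖x‖) / (-t) ∧ |(q i) t x| ≤ K / (-t) + K * (1 + ‖x‖) / Real.sqrt
      (-t) ^ 3) ∧ (∀ t < 0, Literature.Analysis.FluidPDE.VectorCalculus.IsDivFree ((v i) t)) ∧ (∀ t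
      < 0, ∀ x, Literature.Analysis.FluidPDE.timeDeriv (v i) t x +
      Literature.Analysis.FluidPDE.convect (u t) ((v i) t) x + Literature.Analysis.FluidPDE.convect
      ((v i) t) (u t) x = Laplacian.laplacian ((v i) t) x - gradient ((q i) t) x))) → ∃ c : Fin 7 →
      ℝ, c ≠ 0 ∧ ∀ t < 0, ∃ b : EuclideanSpace ℝ (Fin 3), ∀ x, ∑ i, c i • v i t x = b) ↔ ∀ t < 0, ∀
      x, u t x = 0) :=
  fun _ _ hA => linearLiouvilleSevenAt_iff_background_eq_zero hA

/-- **Registered stub `stub_linearLiouvilleSevenSmallConstant` of item stmt-NavierStokesRegularity-4054**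
(raw vocabulary of the route file): `LinearLiouvilleSeven` restricted to Type-I constants `C ≤ ε`
holds, for a universal `ε > 0`. [cite: Leray1934, (3.9); KochNadirashviliSereginSverak2009, §4 p. 8] -/
theorem stub_linearLiouvilleSevenSmallConstant :
    ∃ ε : ℝ, 0 < ε ∧ ∀ (C : ℝ) (u : ℝ → EuclideanSpace ℝ (Fin 3) → EuclideanSpace ℝ (Fin 3)),
      ContDiffOn ℝ (⊤ : ℕ∞) (Function.uncurry u) (Set.Iio 0 ×ˢ Set.univ) ∧ (∀ t < 0,
      Literature.Analysis.FluidPDE.VectorCalculus.IsDivFree (u t)) ∧ (∀ s t : ℝ, s < t → t < 0 → ∀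
      x, u t x = Literature.Analysis.FluidPDE.heatFlow (u s) (t - s) x - ∫ τ in Set.Ioo s t, ∫ y,
      Literature.Analysis.FluidPDE.oseenKernel (t - τ) (x - y) (u τ y) (u τ y)) ∧
      Literature.Analysis.FluidPDE.HasTypeITimeDecay C u → C ≤ ε → ∀ (v : Fin 7 → ℝ → EuclideanSpace
      ℝ (Fin 3) → EuclideanSpace ℝ (Fin 3)) (q : Fin 7 → ℝ → EuclideanSpace ℝ (Fin 3) → ℝ), (∀ i,
      (ContDiffOn ℝ (⊤ : ℕ∞) (Function.uncurry (v i)) (Set.Iio 0 ×ˢ Set.univ) ∧ ContDiffOn ℝ (⊤ :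
      ℕ∞) (Function.uncurry (q i)) (Set.Iio 0 ×ˢ Set.univ) ∧ (∃ K : ℝ, ∀ t < 0, ∀ x, ‖(v i) t x‖ ≤ K
      / Real.sqrt (-t) + K * (1 + ‖x‖) / (-t) ∧ |(q i) t x| ≤ K / (-t) + K * (1 + ‖x‖) / Real.sqrt
      (-t) ^ 3) ∧ (∀ t < 0, Literature.Analysis.FluidPDE.VectorCalculus.IsDivFree ((v i) t)) ∧ (∀ t
      < 0, ∀ x, Literature.Analysis.FluidPDE.timeDeriv (v i) t x +
      Literature.Analysis.FluidPDE.convect (u t) ((v i) t) x + Literature.Analysis.FluidPDE.convect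
      ((v i) t) (u t) x = Laplacian.laplacian ((v i) t) x - gradient ((q i) t) x))) → ∃ c : Fin 7 →
      ℝ, c ≠ 0 ∧ ∀ t < 0, ∃ b : EuclideanSpace ℝ (Fin 3), ∀ x, ∑ i, c i • v i t x = b :=
  linearLiouvilleSeven_smallConstant

end Summit.NavierStokesRegularity.NavierStokesRegularity.Theorems

end
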